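import Summits.Ventures.HSemireg.WedgeHankelSecantRank

/-!
# Venture HSemireg — HANKEL SYMMETRY `rank H_k(q) = rank H_{m−k}(q)` and the secant rank law in the MIRROR regime:
# `rank H_k(Σ_{i<r} A_i λ_i^•) = min(r, m+1−k)` for `r ≤ k+1`

HONEST FRAMING. Part of the Lean index of the computation cell `pub-hsemireg` (seat p10 gen 14, Sunday typer «UNIFORM-IN-n»).
LINEAR ALGEBRA OF HANKEL (catalecticant) MATRICES over a field ONLY: no variety, no cohomology theory, no sheaf, no Ext group and no
semiregularity map is constructed here; nothing here says that HC / HC_CM / HC_AV holds; no Literature fact is declared or used.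
Custodian versions cited: theory/FORMULA-N.md PART A §2.6 THEOREM H; STRUCTURE.md v1.0-SIGNED 9b196a05977dd067 §1.1 C15 (the palindrome of the
rank rows).  The dictionary is QUOTED, never asserted.

WHAT IS KEYED.  D1 (`WedgeHankelSecantRank`): `rank H_k(Σ_{i<r} A_i λ_i^•) = min(r, k+1)` whenever `r ≤ m+1−k`; th-7's `WedgeHankelDual` (tree) proves the
duality of WEDGE ranks in mirror degrees by the exterior-algebra complement.  THIS FILE adds the elementary matrix symmetry and the mirror regime:
* §1 **`hankel1_transpose`: `H_k(q)ᵀ = H_{m−k}(q)`** (reindexed; `k ≤ m`) ⇒ **`rank_hankel1_symm`: `rank H_k(q) = rank H_{m−k}(q)` for EVERY `q`**.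
* §2 **`rank_hankel1_secSeq_eq_min'`: `rank H_k(Σ_{i<r} A_i λ_i^•) = min(r, m+1−k)` whenever `r ≤ k+1`** (distinct nodes, non-zero weights) — with D1,
  `rank H_k = min(r, k+1, m+1−k)` as soon as `r ≤ k+1` OR `r ≤ m+1−k`; the kernel NUMBER in the mirror regime
  (`finrank_ker_wedge_w_secSeq_add'`: `dim ker + min(r, m+1−k)·C(m,k) = C(2m,k)`).
Namespace `Summit.Ventures.HSemireg.Wedge.HankelSecant` (continued); new names only.
-/

open Module
open scoped Matrix

namespace Summit.Ventures.HSemireg.Wedge.HankelSecant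

open Summit.Ventures.HSemireg.Wedge Summit.Ventures.HSemireg.Wedge.Hankel

variable (K : Type*) [Field K]

/-! ## §1. Hankel symmetry -/

variable {K} in
omit [Field K] in
/-- **`H_k(q)ᵀ = H_{m−k}(q)`** up to the reindexing `Fin (m+1−k) ≃ Fin ((m−k)+1)`, `Fin (k+1) ≃ Fin (m+1−(m−k))` (`k ≤ m`): both read `q_{i+s}`. -/
theorem hankel1_transpose {m k : ℕ} (hk : k ≤ m) (q : ℕ → K) :
    (hankel1 K m k q)ᵀ = (hankel1 K m (m - k) q).submatrix (finCongr (by omega)) (finCongr (by omega)) := by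
  ext s i
  simp only [Matrix.transpose_apply, hankel1, Matrix.submatrix_apply, Matrix.of_apply, finCongr_apply, Fin.val_cast]
  rw [Nat.add_comm]

/-- **HANKEL SYMMETRY: `rank H_k(q) = rank H_{m−k}(q)`** for every coefficient sequence `q` and `k ≤ m` (every field). -/
theorem rank_hankel1_symm {m k : ℕ} (hk : k ≤ m) (q : ℕ → K) : (hankel1 K m k q).rank = (hankel1 K m (m - k) q).rank := by
  rw [← Matrix.rank_transpose, hankel1_transpose hk, Matrix.rank_submatrix]

/-- hence, with th-7's THEOREM H, the PALINDROME of the rank row up to the binomial factor: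
`rank(θ ↦ θ ∧ w_m(q) ∣ ⋀^k) · C(m, m−k) = rank(θ ↦ θ ∧ w_m(q) ∣ ⋀^{m−k}) · C(m, k)` … stated as the Hankel factor being the same. -/
theorem finrank_range_wedge_w_symm {m k : ℕ} (hk : k ≤ m) (q : ℕ → K) :
    finrank K (LinearMap.range (wedge K m k (w K m m q))) = m.choose k * (hankel1 K m (m - k) q).rank := by
  rw [hankelLaw_model, rank_hankel1_symm K hk]

/-! ## §2. The secant rank law in the mirror regime -/

variable {K} in
/-- **`rank H_k(Σ_{i<r} A_i λ_i^•) = min(r, m+1−k)` whenever `r ≤ k + 1`** (`k ≤ m`; distinct nodes, non-zero weights, every field): D1's law at the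
mirror degree `m − k`, transported by Hankel symmetry. -/
theorem rank_hankel1_secSeq_eq_min' {m k r : ℕ} (hk : k ≤ m) (hrk : r ≤ k + 1) {A lam : Fin r → K} (hA : ∀ i, A i ≠ 0)
    (hlam : Function.Injective lam) : (hankel1 K m k (secSeq K A lam)).rank = min r (m + 1 - k) := by
  rw [rank_hankel1_symm K hk, rank_hankel1_secSeq_eq_min (k := m - k) (by omega) hA hlam]
  congr 1
  omega

variable {K} in
/-- both regimes at once: **`rank H_k(Σ_{i<r} A_i λ_i^•) = min(r, min(k+1, m+1−k))` whenever `r ≤ k + 1` or `r ≤ m + 1 − k`** (`k ≤ m`). -/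
theorem rank_hankel1_secSeq_eq_min_min {m k r : ℕ} (hk : k ≤ m) (hr : r ≤ k + 1 ∨ r ≤ m + 1 - k) {A lam : Fin r → K}
    (hA : ∀ i, A i ≠ 0) (hlam : Function.Injective lam) :
    (hankel1 K m k (secSeq K A lam)).rank = min r (min (k + 1) (m + 1 - k)) := by
  rcases hr with h | h
  · rw [rank_hankel1_secSeq_eq_min' hk h hA hlam]
    rcases le_total (k + 1) (m + 1 - k) with h' | h'
    · rw [min_eq_left h', min_eq_left h, min_eq_left (h.trans h')]
    · rw [min_eq_right h']
  · rw [rank_hankel1_secSeq_eq_min h hA hlam]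
    rcases le_total (k + 1) (m + 1 - k) with h' | h'
    · rw [min_eq_left h']
    · rw [min_eq_right h', min_eq_left h, min_eq_left (h.trans h')]

/-- `dim ⋀^k K^{2m} = C(2m, k)` (private copy). -/
private lemma finrank_exteriorPower₃ (m k : ℕ) : finrank K (⋀[K]^k (In m → K)) = (m + m).choose k := by
  rw [exteriorPower.finrank_eq, finrank_fintype_fun_eq_card, Fintype.card_fin]

variable {K} in
/-- the kernel NUMBER in the mirror regime: **`dim ker(θ ↦ θ ∧ w_m(q) ∣ ⋀^k) + min(r, m+1−k)·C(m,k) = C(2m,k)`** for `r ≤ k + 1`, `k ≤ m`. -/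
theorem finrank_ker_wedge_w_secSeq_add' {m k r : ℕ} (hk : k ≤ m) (hrk : r ≤ k + 1) {A lam : Fin r → K} (hA : ∀ i, A i ≠ 0)
    (hlam : Function.Injective lam) :
    finrank K (LinearMap.ker (wedge K m k (w K m m (secSeq K A lam)))) + min r (m + 1 - k) * m.choose k = (m + m).choose k := by
  have h := LinearMap.finrank_range_add_finrank_ker (wedge K m k (w K m m (secSeq K A lam)))
  rw [hankelLaw_model, rank_hankel1_secSeq_eq_min' hk hrk hA hlam, finrank_exteriorPower₃] at h
  rw [← h]; ring

end Summit.Ventures.HSemireg.Wedge.HankelSecant
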